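import Summits.Ventures.Crystal3D.Theorems.StickyWulffConstantNoReconstructionGainExactDefs
import Summits.Ventures.Crystal3D.Theorems.StickyWulffConstantNoReconstructionGainLatticeAdhesion
import Summits.Ventures.Crystal3D.Theorems.StickyWulffConstantNoReconstructionGainCubicFrame
import Literature.MathematicalPhysics.StatisticalMechanics.MuGSC
import HarnessLib

/-!
# Exact zero gain gives the adhesion atom with constant `0` on the compatible sector
# (line `replication-exactness`, stub COMPATIBLE)

HONEST FRAMING. Part of the venture `Summits/Ventures/Crystal3D` (cell `crystal3d-full`), supports the
crux `NoReconstructionGain` (stmt-Ventures-19144, route `route-Ventures-StickyWulffConstant`), line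
`replication-exactness` (skeleton v2, lead wulff-p1 g17; objects in `…NoReconstructionGainExactDefs`).
This file lands the registered stub

* `stub_compatibleAdhesion_of_exactZeroGain : ExactZeroGain → ∀ R ≥ 3, CompatibleAdhesion R` — EXACT₀
  implies `#cross(P, X∖P) ≤ D(X∖P)` (no `C ρ`) for every unit packing `X` around the disc slab sample
  `P = P_ρ(ν,R)` whose film keeps distance `≥ 1` from every slab site off the sample,

with its tools: `fcc_uniformlyDiscrete` / `plugSet_finite` (plug sets are finite), `card_cross_eq_sum`
(the cross count as a sum over film balls), `card_filter_le_plugSet_ncard` (substrate partners inside a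
half-crystal are plugs), `abs_inner_sub_le_dist`, and the **covering-radius dichotomy**
`film_height_dichotomy`: a film ball of a compatible packing lies above `−R − 3/4` or below `−2R + 3/4`
(its nearest lattice site, within `1/√2` by `exists_fcc_dist_sq_le_half`, cannot be a slab site).

Proof of the stub: split the film at height `−3R/2`; the upper part is a film on `halfCrystal ν (−R)`,
the lower part a film on `halfCrystal (−ν) (2R)` (sites on the far side are `≥ R/2 > 1` away); the parts
are `> R − 3/2 ≥ 1` apart in height, so `D(X∖P) = D(upper) + D(lower)`
(`contactDeficiency_sdiff_split`); substrate contacts are plugs; EXACT₀ twice.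

WHAT THIS IS NOT: EXACT₀ itself is the crux proper in exact form (`stub_noCriminal`, open); the wrapped
sector is the open residual `stub_wrappedCoreAdhesion`; rung F-C1 not moved.
-/

noncomputable section

namespace Summit.Ventures.Crystal3D.Theorems

open Literature.MathematicalPhysics.StatisticalMechanics (fccStacking barlowStacking constHagg
  isHaggSeq_const le_dist_of_mem_barlowStacking_ideal contactDeficiency orderedContacts UniformlyDiscrete)
open scoped InnerProductSpace
open Finset

/-! ## Small tools -/

/-- The model fcc lattice is uniformly discrete (sites pairwise `≥ 1` apart). -/
theorem fcc_uniformlyDiscrete : UniformlyDiscrete (fccStacking 1 (Real.sqrt (2 / 3))) := by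
  refine ⟨1, one_pos, fun x hx y hy hxy => ?_⟩
  have hh : Real.sqrt (2 / 3) ^ 2 = 2 / 3 * (1 : ℝ) ^ 2 := by
    rw [Real.sq_sqrt (by norm_num)]; norm_num
  exact le_dist_of_mem_barlowStacking_ideal isHaggSeq_const one_pos hh hx hy hxy

/-- The plug set of a ball is finite. -/
theorem plugSet_finite (ν : EuclideanSpace ℝ (Fin 3)) (s : ℝ) (q : EuclideanSpace ℝ (Fin 3)) :
    (plugSet ν s q).Finite := by
  refine (fcc_uniformlyDiscrete.finite_inter_closedBall q 1).subset ?_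
  rintro p ⟨⟨hpΛ, -⟩, hd⟩
  exact ⟨hpΛ, Metric.mem_closedBall.2 (by rw [dist_comm]; exact hd.le)⟩

/-- The cross count `#{(p,q) ∈ P × F : dist p q = 1}` as a sum over the film balls. -/
theorem card_cross_eq_sum (P F : Finset (EuclideanSpace ℝ (Fin 3))) :
    ((P ×ˢ F).filter fun pq => dist pq.1 pq.2 = 1).card =
      ∑ q ∈ F, (P.filter fun p => dist p q = 1).card := by
  classical
  rw [Finset.card_filter, Finset.sum_product_right]
  refine Finset.sum_congr rfl fun q _ => ?_
  rw [Finset.card_filter]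

/-- The substrate partners of a film ball inside a half-crystal are plugs. -/
theorem card_filter_le_plugSet_ncard (ν : EuclideanSpace ℝ (Fin 3)) (s : ℝ)
    (P : Finset (EuclideanSpace ℝ (Fin 3))) (q : EuclideanSpace ℝ (Fin 3))
    (hP : ∀ p ∈ P, dist p q = 1 → p ∈ halfCrystal ν s) :
    (P.filter fun p => dist p q = 1).card ≤ (plugSet ν s q).ncard := by
  classical
  rw [← Set.ncard_coe_finset]
  refine Set.ncard_le_ncard ?_ (plugSet_finite ν s q)
  intro p hp
  rw [Finset.mem_coe, Finset.mem_filter] at hp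
  exact ⟨hP p hp.1 hp.2, by rw [dist_comm]; exact hp.2⟩

/-- Height differences are bounded by distances (`‖ν‖ = 1`). -/
theorem abs_inner_sub_le_dist {ν : EuclideanSpace ℝ (Fin 3)} (hν : ‖ν‖ = 1)
    (x y : EuclideanSpace ℝ (Fin 3)) : |⟪x, ν⟫_ℝ - ⟪y, ν⟫_ℝ| ≤ dist x y := by
  rw [← inner_sub_left, dist_eq_norm]
  calc |⟪x - y, ν⟫_ℝ| ≤ ‖x - y‖ * ‖ν‖ := abs_real_inner_le_norm _ _
    _ = ‖x - y‖ := by rw [hν, mul_one]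

/-- **Covering-radius dichotomy.**  A film ball of a compatible packing around the slab sample lies
above `−R − 3/4` or below `−2R + 3/4`: the nearest lattice site (within `1/√2`) is not a slab site. -/
theorem film_height_dichotomy {ν : EuclideanSpace ℝ (Fin 3)} (hν : ‖ν‖ = 1) {R : ℝ}
    {X P : Finset (EuclideanSpace ℝ (Fin 3))}
    (hX : ∀ p ∈ X, ∀ q ∈ X, p ≠ q → 1 ≤ dist p q) (hPX : P ⊆ X)
    (hc : ∀ q ∈ X \ P, ∀ p ∈ fccStacking 1 (Real.sqrt (2 / 3)),
      -(2 * R) ≤ ⟪p, ν⟫_ℝ → ⟪p, ν⟫_ℝ ≤ -R → p ∉ P → 1 ≤ dist q p)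
    {q : EuclideanSpace ℝ (Fin 3)} (hq : q ∈ X \ P) :
    -R - 3 / 4 < ⟪q, ν⟫_ℝ ∨ ⟪q, ν⟫_ℝ < -(2 * R) + 3 / 4 := by
  obtain ⟨z, hzΛ, hz⟩ := exists_fcc_dist_sq_le_half q
  have hqz : dist q z < 1 := by
    have h1 : dist q z ^ 2 ≤ 1 / 2 := by rw [dist_eq_norm]; exact hz
    nlinarith [dist_nonneg (x := q) (y := z)]
  have hdh : |⟪q, ν⟫_ℝ - ⟪z, ν⟫_ℝ| ≤ 3 / 4 := by
    have h1 := abs_inner_sub_le_dist hν q z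
    have h2 : dist q z ^ 2 ≤ 1 / 2 := by rw [dist_eq_norm]; exact hz
    have h3 : dist q z ≤ 3 / 4 := by nlinarith [dist_nonneg (x := q) (y := z)]
    linarith
  have hzslab : ¬ (-(2 * R) ≤ ⟪z, ν⟫_ℝ ∧ ⟪z, ν⟫_ℝ ≤ -R) := by
    rintro ⟨h1, h2⟩
    by_cases hzP : z ∈ P
    · have hne : q ≠ z := by
        rintro rfl; exact (Finset.mem_sdiff.1 hq).2 hzP
      have := hX q (Finset.mem_sdiff.1 hq).1 z (hPX hzP) hne
      linarith
    · have := hc q hq z hzΛ h1 h2 hzP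
      linarith
  rcases abs_le.1 hdh with ⟨hl, hu⟩
  by_cases h1 : -(2 * R) ≤ ⟪z, ν⟫_ℝ
  · have h2 : -R < ⟪z, ν⟫_ℝ := by
      by_contra h2; exact hzslab ⟨h1, not_lt.1 h2⟩
    left; linarith
  · right; push Not at h1; linarith

/-- **STUB `stub_compatibleAdhesion_of_exactZeroGain` of the line `replication-exactness` (M).**
EXACT₀ implies the adhesion atom with constant `0` on the compatible sector, for every `R ≥ 3`:
split the film by height at `−3R/2`; by the covering-radius dichotomy the upper part lies above
`−R − 3/4` and is a film on `halfCrystal ν (−R)`, the lower part lies below `−2R + 3/4` and is a film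
on `halfCrystal (−ν) (2R)`; the two parts are `> 1` apart, so `D(X∖P) = D(upper) + D(lower)`;
substrate contacts are plugs; EXACT₀ twice. -/
theorem stub_compatibleAdhesion_of_exactZeroGain :
    ExactZeroGain → ∀ R : ℝ, 3 ≤ R → CompatibleAdhesion R := by
  classical
  intro hE R hR ν hν ρ X P hX hPX hP hc
  set F := X \ P with hF
  set Fu := F.filter fun q => -(3 * R / 2) < ⟪q, ν⟫_ℝ with hFu
  set Fl := F.filter fun q => ¬ -(3 * R / 2) < ⟪q, ν⟫_ℝ with hFl
  have hFuF : Fu ⊆ F := Finset.filter_subset _ _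
  have hFlF : Fl ⊆ F := Finset.filter_subset _ _
  have hFX : F ⊆ X := Finset.sdiff_subset
  -- heights of the two parts
  have hup : ∀ q ∈ Fu, -R - 3 / 4 < ⟪q, ν⟫_ℝ := by
    intro q hq
    rw [hFu, Finset.mem_filter] at hq
    rcases film_height_dichotomy hν hX hPX hc hq.1 with h | h
    · exact h
    · linarith [hq.2]
  have hlow : ∀ q ∈ Fl, ⟪q, ν⟫_ℝ < -(2 * R) + 3 / 4 := by
    intro q hq
    rw [hFl, Finset.mem_filter] at hq
    rcases film_height_dichotomy hν hX hPX hc hq.1 with h | h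
    · exact absurd (by linarith : -(3 * R / 2) < ⟪q, ν⟫_ℝ) hq.2
    · exact h
  -- the upper part is a film on `H(ν, −R)`
  have hfilm_u : IsFilmOn ν (-R) Fu := by
    refine ⟨fun q hq q' hq' hne => hX q (hFX (hFuF hq)) q' (hFX (hFuF hq')) hne, ?_⟩
    intro q hq p hp
    obtain ⟨hpΛ, hph⟩ := hp
    have hqF : q ∈ X \ P := hFuF hq
    by_cases hpP : p ∈ P
    · have hne : q ≠ p := by rintro rfl; exact (Finset.mem_sdiff.1 hqF).2 hpP
      exact hX q (hFX hqF) p (hPX hpP) hne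
    by_cases h2 : -(2 * R) ≤ ⟪p, ν⟫_ℝ
    · exact hc q hqF p hpΛ h2 hph hpP
    · push Not at h2
      have h4 := hup q hq
      have h3 : ⟪q, ν⟫_ℝ - ⟪p, ν⟫_ℝ ≤ dist q p :=
        (le_abs_self _).trans (abs_inner_sub_le_dist hν q p)
      linarith
  -- the lower part is a film on `H(−ν, 2R)`
  have hνn : ‖-ν‖ = 1 := by rw [norm_neg, hν]
  have hfilm_l : IsFilmOn (-ν) (2 * R) Fl := by
    refine ⟨fun q hq q' hq' hne => hX q (hFX (hFlF hq)) q' (hFX (hFlF hq')) hne, ?_⟩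
    intro q hq p hp
    obtain ⟨hpΛ, hph⟩ := hp
    rw [inner_neg_right] at hph
    have hqF : q ∈ X \ P := hFlF hq
    by_cases hpP : p ∈ P
    · have hne : q ≠ p := by rintro rfl; exact (Finset.mem_sdiff.1 hqF).2 hpP
      exact hX q (hFX hqF) p (hPX hpP) hne
    by_cases h2 : ⟪p, ν⟫_ℝ ≤ -R
    · exact hc q hqF p hpΛ (by linarith) h2 hpP
    · push Not at h2
      have h4 := hlow q hq
      have : ⟪p, ν⟫_ℝ - ⟪q, ν⟫_ℝ ≤ dist q p := by
        have h := abs_inner_sub_le_dist hν p q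
        rw [dist_comm] at h
        exact (le_abs_self _).trans h
      linarith
  -- EXACT₀ on both parts
  have hEu := hE ν hν (-R) Fu hfilm_u
  have hEl := hE (-ν) hνn (2 * R) Fl hfilm_l
  -- substrate contacts are plugs
  have hcross_u : (((P ×ˢ Fu).filter fun pq => dist pq.1 pq.2 = 1).card : ℝ) ≤ plugCount ν (-R) Fu := by
    rw [card_cross_eq_sum, plugCount]
    push_cast
    refine Finset.sum_le_sum fun q _ => ?_
    exact_mod_cast card_filter_le_plugSet_ncard ν (-R) P q fun p hp _ =>
      ⟨((hP p).1 hp).1, ((hP p).1 hp).2.2.1⟩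
  have hcross_l : (((P ×ˢ Fl).filter fun pq => dist pq.1 pq.2 = 1).card : ℝ) ≤
      plugCount (-ν) (2 * R) Fl := by
    rw [card_cross_eq_sum, plugCount]
    push_cast
    refine Finset.sum_le_sum fun q _ => ?_
    exact_mod_cast card_filter_le_plugSet_ncard (-ν) (2 * R) P q fun p hp _ =>
      ⟨((hP p).1 hp).1, by rw [inner_neg_right]; linarith [((hP p).1 hp).2.1]⟩
  -- the cross count splits over the two parts
  have hsplitX : ((P ×ˢ F).filter fun pq => dist pq.1 pq.2 = 1).card =
      ((P ×ˢ Fu).filter fun pq => dist pq.1 pq.2 = 1).card +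
        ((P ×ˢ Fl).filter fun pq => dist pq.1 pq.2 = 1).card := by
    rw [card_cross_eq_sum, card_cross_eq_sum, card_cross_eq_sum, hFu, hFl,
      Finset.sum_filter_add_sum_filter_not]
  -- the deficiency splits: no contact between the parts
  have hFlu : F \ Fu = Fl := by
    rw [hFu, hFl, Finset.filter_not]
  have hD : contactDeficiency F = contactDeficiency Fu + contactDeficiency Fl := by
    have h := contactDeficiency_sdiff_split (X := F) (P := Fu) hFuF
    rw [hFlu] at h
    have h0 : ((Fu ×ˢ Fl).filter fun pq => dist pq.1 pq.2 = 1).card = 0 := by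
      rw [Finset.card_eq_zero, Finset.filter_eq_empty_iff]
      intro pq hpq
      rw [Finset.mem_product] at hpq
      have h1 := hup pq.1 hpq.1
      have h2 := hlow pq.2 hpq.2
      have h3 : ⟪pq.1, ν⟫_ℝ - ⟪pq.2, ν⟫_ℝ ≤ dist pq.1 pq.2 :=
        (le_abs_self _).trans (abs_inner_sub_le_dist hν pq.1 pq.2)
      intro hd
      rw [hd] at h3
      linarith
    rw [h, h0]; push_cast; ring
  -- assemble
  rw [hsplitX, hD]; push_cast
  linarith
end Summit.Ventures.Crystal3D.Theorems

end
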